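import Literature.NumberTheory.LFunctions.CertifiedDirichletLTuringTrudgianTheorem38
import Literature.NumberTheory.LFunctions.TuringMethodTrudgianNumerics
import HarnessLib

/-!
# Trudgian's (3.17)–(3.18) at `(c, d) = (1.17, 0.88)` and `(1.1, 0.8)`: from certified values of
# `log ζ` to the printed constants of Trudgian 2011 Thm. 3.3 and Platt 2016 Thm. 5.4

T. S. Trudgian, *Improvements to Turing's method*, Math. Comp. **80** (2011), §3.5: Theorem 3.8 at
`(c, d) = (1.17, 0.88)` gives Theorem 3.3, `|∫_{t₁}^{t₂} S(t,χ) dt| ≤ 1.975 + 0.084 log(Qt₂/2π)`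
(`a(1.17,0.88) = 1.9744`, `b(1.17,0.88) = 0.0833`); D. J. Platt, Math. Comp. **85** (2016) Thm. 5.4:
at `(c, d) = (1.1, 0.8)`, `|∫_T^{T+h} S_χ| ≤ 2.17618 + 0.0679956 log(q(T+h)/2π)`.  This file is the
ANALYTIC half of the discharge of the named facts `trudgian2011_theorem33` and `platt2016_theorem54`
(`CertifiedDirichletLTuringTrudgian.lean`); the certified evaluations (`native_decide`) and the `_holds`
theorems are the companions `CertifiedDirichletLTuringTrudgianConstants33.lean` / `…54.lean`.

* `TuringDirichlet.abs_integral_lfunctionArgS_le_of_forall_ne` — a bound `|∫_{t₁}^{t₂} S_χ| ≤ A + B log(Qt₂/2π)`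
  extends from non-ordinates `t₀ < t₁ ≤ t₂` to all `t₀ < t₁ < t₂` (continuity of both sides, density of
  non-ordinates; as in `CertifiedDirichletLTuringTrudgianTheorem38.lean`).
* `TuringDirichlet.abs_pi_mul_integral_lfunctionArgS_le₂` — Theorem 3.8 for one character, two-sided, with
  the second-order constant `A₂(c,d,t₀)` of `CertifiedDirichletLTuringTrudgianTheorem38.lean` (whose
  `Γ`-error at `t₀ = 50` is `≈ 0.0015–0.0018` against the printed budget `15d²/t₀² ≈ 0.004–0.005`: this
  slack is what makes the printed four- and six-digit constants certifiable by trapezoid meshes).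
* `TuringDirichlet.neg_turingI_eq` — `−I(d) = ∫_{½+d}^{1+2d} log ζ + ½∫_{1+4d}^∞ log ζ + ∫_{½+d}^{½+2d} log ζ`
  (three non-negative pieces); `setIntegral_logZeta_le`, `setIntegral_Ioi_log_norm_zeta_le` — cutting
  the tails at `σ = 30` (`∫_{30}^∞ log ζ ≤ 10⁻⁸`, the tree's `setIntegral_Ioi_log_norm_riemannZeta_tail_le`).
* `TrudgianNumerics.integral_le_of_meshCheck`, `TrudgianNumerics.secant_of_check` — soundness of the two
  Boolean shapes evaluated by the companions, from the tree's certified checker (`checkNode`,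
  `checkNodes`, `integral_le_trapSumQ`: `log ζ` is convex on `(1, ∞)`, so along certified nodes the
  integral is below the trapezoid sum; `neg_re_logDeriv_riemannZeta_le_secant` for `−ζ'/ζ`).
* `trudgian2011_theorem33_of_bounds`, `platt2016_theorem54_of_bounds` — the arithmetic: granted the
  certified values (`log ζ(c)`, `∫_c^{30} log ζ`, the secant nodes at `½+d`, the three `I(d)` meshes),
  `A₂(c,d,50) ≤ 6.2016 ≤ 1.975π` resp. `≤ 6.8356 ≤ 2.17618π`, and `b₁ + b₂ ≤ 0.084π` resp. `≤ 0.0679956π`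
  (`2ζ'/ζ(1+2d) ≤ 0` dropped as in print).

Everything here is a theorem with standard axioms; no definition, no named fact.

## References
* T. S. Trudgian, Improvements to Turing's method, Math. Comp. 80 (2011), §3 Theorems 3.3, 3.8, (3.17)–(3.18),
  §3.5. [Trudgian2011]
* D. J. Platt, Numerical computations concerning the GRH, Math. Comp. 85 (2016), Theorem 5.4 p. 3014.
  [Platt2016GRH]
* R. Rumely, Math. Comp. 61 (1993), Lemma 3 p. 429. [Rumely1993ERH]
-/

noncomputable section

open Complex Set MeasureTheory intervalIntegral Filter Topology
open scoped Real

namespace Literature.NumberTheory.LFunctions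

open DirichletTheta DirichletCharacter ExplicitPsiChar Trudgian2011Dirichlet Booker2006Turing
  TrudgianNumerics ZetaNumerics

namespace TuringDirichlet

variable {q : ℕ} [NeZero q] {χ : DirichletCharacter ℂ q}

/-! ### From non-ordinates to all heights (continuity of both sides) -/

/-- Between any two reals there is a height that is the ordinate of no non-trivial zero of
`L(s, χ)` (`χ ≠ 1`). [folklore] -/
private theorem exists_not_ordinate_mem_Ioo₃ (h1 : χ ≠ 1) {a b : ℝ} (hab : a < b) :
    ∃ u ∈ Ioo a b, ∀ ρ ∈ charNontrivialZeros χ, ρ.im ≠ u := by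
  set F : Set ℝ := Complex.im '' lfunctionZeroBox χ (max |a| |b|) with hF
  have hFf : F.Finite := (lfunctionZeroBox_finite h1 _).image _
  obtain ⟨u, huI, huF⟩ := ((Set.Ioo_infinite hab).sdiff hFf).nonempty
  refine ⟨u, huI, fun ρ hρ hρu ↦ huF ⟨ρ, ?_, hρu⟩⟩
  rw [mem_charNontrivialZeros] at hρ
  refine mem_lfunctionZeroBox.2 ⟨hρ.1, hρ.2.1, hρ.2.2, ?_⟩
  rw [hρu, abs_le]
  constructor
  · have : -|a| ≤ a := neg_abs_le a
    linarith [huI.1, le_max_left |a| |b|]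
  · linarith [huI.2, le_abs_self b, le_max_right |a| |b|]

/-- **A bound `|∫_{t₁}^{t₂} S_χ| ≤ A + B log(Qt₂/2π)` extends from non-ordinates to all heights**:
if it holds for all `t₀ < t₁ ≤ t₂` that are ordinates of no non-trivial zero (`t₀ ≥ 0`), it holds
for all `t₀ < t₁ < t₂` — `S_χ` is locally integrable (so `∫S_χ` is continuous in both limits),
`log(Qt/2π)` is continuous, and the non-ordinates are dense. [cite: Rumely1993ERH, Lemma 3 p. 429] -/
theorem abs_integral_lfunctionArgS_le_of_forall_ne (hq : 1 < q) (hχ : χ.IsPrimitive)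
    {t₀ A B : ℝ} (ht₀ : 0 ≤ t₀)
    (H : ∀ t₁ t₂ : ℝ, t₀ < t₁ → t₁ ≤ t₂ → (∀ ρ ∈ charNontrivialZeros χ, ρ.im ≠ t₁) →
      (∀ ρ ∈ charNontrivialZeros χ, ρ.im ≠ t₂) →
      |∫ t in t₁..t₂, lfunctionArgS χ t| ≤ A + B * Real.log (q * t₂ / (2 * π)))
    {t₁ t₂ : ℝ} (h01 : t₀ < t₁) (h12 : t₁ < t₂) :
    |∫ t in t₁..t₂, lfunctionArgS χ t| ≤ A + B * Real.log (q * t₂ / (2 * π)) := by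
  have hq1 : q ≠ 1 := by omega
  have h1 : χ ≠ 1 := SelbergDirichlet.ne_one_of_isPrimitive hq1 hχ
  have hqR : (0 : ℝ) < q := by exact_mod_cast (show 0 < q by omega)
  have hS : ∀ a b, IntervalIntegrable (lfunctionArgS χ) volume a b :=
    Booker2006Turing.intervalIntegrable_lfunctionArgS_of_isPrimitive hχ hq
  set LQ : ℝ → ℝ := fun u ↦ Real.log (q * u / (2 * π)) with hLQ
  have hLQc : ContinuousOn LQ (Ioi 0) := by
    have hc' : Continuous fun u : ℝ ↦ (q : ℝ) * u / (2 * π) := by fun_prop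
    refine hc'.continuousOn.log fun u hu ↦ ?_
    simp only [mem_Ioi] at hu
    positivity
  -- Step A: `t₁` a non-ordinate, `t₂ ≥ t₁` arbitrary
  have stepA : ∀ t₁ t₂ : ℝ, t₀ < t₁ → t₁ ≤ t₂ → (∀ ρ ∈ charNontrivialZeros χ, ρ.im ≠ t₁) →
      |∫ t in t₁..t₂, lfunctionArgS χ t| ≤ A + B * LQ t₂ := by
    intro t₁ t₂ h01 h12 hz₁
    have ht₂0 : 0 < t₂ := by linarith
    set P : ℝ → ℝ := fun u ↦ ∫ t in t₁..u, lfunctionArgS χ t with hP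
    have hPc : Continuous P := intervalIntegral.continuous_primitive hS t₁
    set F : ℝ → ℝ := fun u ↦ |P u| - (A + B * LQ u) with hF
    have hFc : ContinuousAt F t₂ := by
      have h1' : ContinuousAt (fun u ↦ |P u|) t₂ := (hPc.continuousAt).abs
      have h2' : ContinuousAt (fun u ↦ A + B * LQ u) t₂ :=
        continuousAt_const.add (continuousAt_const.mul (hLQc.continuousAt (Ioi_mem_nhds ht₂0)))
      exact h1'.sub h2'
    by_contra hcon
    have hpos : 0 < F t₂ := by
      simp only [hF, hP]
      linarith
    have hev := hFc.eventually (lt_mem_nhds hpos)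
    obtain ⟨δ, hδ, hball⟩ := Metric.eventually_nhds_iff.1 hev
    obtain ⟨u, huI, hzu⟩ := exists_not_ordinate_mem_Ioo₃ h1 (show t₂ < t₂ + δ by linarith)
    have hu : dist u t₂ < δ := by
      rw [Real.dist_eq, abs_lt]; constructor <;> linarith [huI.1, huI.2]
    have hFu : 0 < F u := hball hu
    have hle := H t₁ u h01 (by linarith [huI.1]) hz₁ hzu
    simp only [hF, hP, hLQ] at hFu
    linarith
  -- Step B: `t₁` arbitrary
  have ht₁0 : 0 < t₁ := by linarith
  set P₂ : ℝ → ℝ := fun v ↦ ∫ t in t₂..v, lfunctionArgS χ t with hP₂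
  have hP₂c : Continuous P₂ := intervalIntegral.continuous_primitive hS t₂
  set G : ℝ → ℝ := fun v ↦ |P₂ v| - (A + B * LQ t₂) with hG
  have hGc : Continuous G := by
    simp only [hG]
    fun_prop
  by_contra hcon
  have hpos : 0 < G t₁ := by
    simp only [hG, hP₂]
    rw [intervalIntegral.integral_symm t₂ t₁, abs_neg] at hcon
    linarith
  have hev := (hGc.continuousAt (x := t₁)).eventually (lt_mem_nhds hpos)
  obtain ⟨δ, hδ, hball⟩ := Metric.eventually_nhds_iff.1 hev
  obtain ⟨v, hvI, hzv⟩ := exists_not_ordinate_mem_Ioo₃ h1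
    (show max t₀ (t₁ - δ) < t₁ from max_lt h01 (by linarith))
  have hv : dist v t₁ < δ := by
    rw [Real.dist_eq, abs_lt]
    constructor <;> linarith [hvI.1, hvI.2, le_max_right t₀ (t₁ - δ)]
  have hGv : 0 < G v := hball hv
  have hle := stepA v t₂ (lt_of_le_of_lt (le_max_left _ _) hvI.1) (by linarith [hvI.2]) hzv
  rw [intervalIntegral.integral_symm t₂ v, abs_neg] at hle
  simp only [hG, hP₂] at hGv
  linarith

/-- **Theorem 3.8 for one character, second-order constant, two-sided, at non-ordinates:**
`π |∫_{t₁}^{t₂} S(t,χ) dt| ≤ A₂(c,d,t₀) + (b₁ + b₂) log(Qt₂/2π)` for `1 ≤ t₀ < t₁ ≤ t₂`.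
[cite: Trudgian2011, §3.4 Theorem 3.8] -/
theorem abs_pi_mul_integral_lfunctionArgS_le₂ (hq : 1 < q) (hχ : χ.IsPrimitive)
    {c d t₀ t₁ t₂ : ℝ} (hc1 : 1 < c) (hc : c ≤ 5 / 4) (hd : 1 / 2 < d) (hd1 : d ≤ 1) (ht₀ : 1 ≤ t₀)
    (h01 : t₀ < t₁) (h12 : t₁ ≤ t₂)
    (hz₁ : ∀ ρ ∈ charNontrivialZeros χ, ρ.im ≠ t₁) (hz₂ : ∀ ρ ∈ charNontrivialZeros χ, ρ.im ≠ t₂) :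
    π * |∫ t in t₁..t₂, lfunctionArgS χ t| ≤
      ((729 / (2048 * t₀ ^ 2) + (c - 1 / 2) * logZeta c + ∫ σ in Ioi c, logZeta σ) +
          (d ^ 2 * Real.log 4 *
              ((2 * (deriv riemannZeta (2 * (1 / 2 + d) : ℝ) / riemannZeta (2 * (1 / 2 + d) : ℝ)).re -
                  (deriv riemannZeta (1 / 2 + d : ℝ) / riemannZeta (1 / 2 + d : ℝ)).re) +
                (25 / (16 * t₀ ^ 2) + (2 / (3 * t₀ ^ 3) + π / (6 * t₀ ^ 2)))) +
            d ^ 2 * (7 / (4 * t₀ ^ 2) + (2 / (3 * t₀ ^ 3) + π / (6 * t₀ ^ 2))) - turingI d)) +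
        ((c - 1 / 2) ^ 2 / 4 + d ^ 2 / 2 * (Real.log 4 - 1)) * Real.log (q * t₂ / (2 * π)) := by
  have hup := pi_mul_integral_lfunctionArgS_le₂ hq hχ hc1 hc hd hd1 ht₀ h01 h12 hz₁ hz₂
  have hlo := neg_pi_mul_integral_lfunctionArgS_le₂ hq hχ hc1 hc hd hd1 ht₀ h01 h12 hz₁ hz₂
  rw [← abs_of_pos Real.pi_pos, ← abs_mul, abs_of_pos Real.pi_pos]
  exact abs_le.2 ⟨by linarith, by linarith⟩

/-- **Rearrangement of Trudgian's `I(d)`** into three non-negative pieces (the form evaluated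
numerically, cf. `trudgianA₂_le`): for `½ < d`,
`−I(d) = ∫_{½+d}^{1+2d} log ζ + ½ ∫_{1+4d}^∞ log ζ + ∫_{½+d}^{½+2d} log ζ`.
[cite: Trudgian2011, §2.2 (definition of I(d))] -/
theorem neg_turingI_eq (d : ℝ) (hd : 1 / 2 < d) :
    -turingI d =
      (∫ σ in (1 / 2 + d)..(1 + 2 * d), Real.log ‖riemannZeta σ‖) +
        1 / 2 * (∫ σ in Ioi (1 + 4 * d), Real.log ‖riemannZeta σ‖) +
        ∫ σ in (1 / 2 + d)..(1 / 2 + 2 * d), Real.log ‖riemannZeta σ‖ := by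
  have hI : IntegrableOn (fun σ : ℝ ↦ Real.log ‖riemannZeta σ‖) (Ioi (1 / 2 + d)) :=
    integrableOn_log_norm_riemannZeta_ofReal (by linarith)
  have S1 := setIntegral_Ioi_eq_intervalIntegral_add (f := fun σ : ℝ ↦ Real.log ‖riemannZeta σ‖)
    (show (1 / 2 + d : ℝ) ≤ 1 + 2 * d by linarith) hI
  have S2 := setIntegral_Ioi_eq_intervalIntegral_add (f := fun σ : ℝ ↦ Real.log ‖riemannZeta σ‖)
    (show (1 + 2 * d : ℝ) ≤ 1 + 4 * d by linarith) (hI.mono_set (Ioi_subset_Ioi (by linarith)))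
  simp only [turingI]
  rw [S1, S2]
  ring

/-- `logZeta σ = log ‖ζ(σ)‖` for `σ > 1`. [folklore] -/
private theorem logZeta_eq_log_norm₃ {σ : ℝ} (hσ : 1 < σ) : logZeta σ = Real.log ‖riemannZeta σ‖ := by
  change Real.log (riemannZeta σ).re = Real.log ‖riemannZeta σ‖
  rw [← Booker2006Turing.bigZ_eq_norm hσ, Booker2006Turing.bigZ]

/-- `∫_{Ioi c} logZeta = ∫_c^{30} log ζ + ∫_{30}^∞ log ζ ≤ ∫_c^{30} log ζ + 10⁻⁸` for `1 < c ≤ 30`.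
[folklore] -/
private theorem setIntegral_logZeta_le {c : ℝ} (hc : 1 < c) (hc30 : c ≤ 30) :
    ∫ σ in Ioi c, logZeta σ ≤ (∫ σ in c..30, Real.log ‖riemannZeta σ‖) + 1 / 10 ^ 8 := by
  have hI : IntegrableOn (fun σ : ℝ ↦ Real.log ‖riemannZeta σ‖) (Ioi c) :=
    integrableOn_log_norm_riemannZeta_ofReal hc
  have hcongr : ∫ σ in Ioi c, logZeta σ = ∫ σ in Ioi c, Real.log ‖riemannZeta σ‖ :=
    setIntegral_congr_fun measurableSet_Ioi fun σ hσ ↦ logZeta_eq_log_norm₃ (hc.trans hσ)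
  rw [hcongr, setIntegral_Ioi_eq_intervalIntegral_add hc30 hI]
  have htail := setIntegral_Ioi_log_norm_riemannZeta_tail_le (X := 30) (by norm_num)
  have htail' : 4 * (2 : ℝ) ^ (-(30 : ℝ)) / Real.log 2 ≤ 1 / 10 ^ 8 := by
    have hl2 := Real.log_two_gt_d9
    rw [Real.rpow_neg (by norm_num), Real.rpow_ofNat, div_le_div_iff₀ (by linarith) (by norm_num)]
    norm_num; linarith
  linarith

/-- `½ ∫_{Ioi X} log ζ ≤ ½ (∫_X^{30} log ζ + 10⁻⁸)` for `3 ≤ X ≤ 30`. [folklore] -/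
private theorem setIntegral_Ioi_log_norm_zeta_le {X : ℝ} (hX : 3 ≤ X) (hX30 : X ≤ 30) :
    ∫ σ in Ioi X, Real.log ‖riemannZeta σ‖ ≤ (∫ σ in X..30, Real.log ‖riemannZeta σ‖) + 1 / 10 ^ 8 := by
  have hI : IntegrableOn (fun σ : ℝ ↦ Real.log ‖riemannZeta σ‖) (Ioi X) :=
    integrableOn_log_norm_riemannZeta_ofReal (by linarith)
  rw [setIntegral_Ioi_eq_intervalIntegral_add hX30 hI]
  have htail := setIntegral_Ioi_log_norm_riemannZeta_tail_le (X := 30) (by norm_num)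
  have htail' : 4 * (2 : ℝ) ^ (-(30 : ℝ)) / Real.log 2 ≤ 1 / 10 ^ 8 := by
    have hl2 := Real.log_two_gt_d9
    rw [Real.rpow_neg (by norm_num), Real.rpow_ofNat, div_le_div_iff₀ (by linarith) (by norm_num)]
    norm_num; linarith
  linarith

/-- `ζ'/ζ(x) ≤ 0` for real `x > 1`. [folklore] -/
private theorem re_logDeriv_zeta_ofReal_nonpos₃ {x : ℝ} (hx : 1 < x) :
    (deriv riemannZeta (x : ℂ) / riemannZeta (x : ℂ)).re ≤ 0 := by
  have h := norm_LSeries_vonMangoldt_le_of_one_lt_re (s := (x : ℂ)) (by simpa using hx)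
  have h0 := (norm_nonneg _).trans h
  simp only [ofReal_re] at h0
  rw [neg_div, neg_re] at h0
  linarith

end TuringDirichlet

/-! ### Soundness of the Boolean checks used by the certificates -/

namespace TrudgianNumerics

/-- **Soundness of a mesh check** (first node certified, tail certified, increasing, right end,
trapezoid sum below the claim): `∫_{x₀/10⁴}^{x_e/10⁴} log ζ ≤ TB` and `log ζ(x₀/10⁴) ≤ q₀/10¹⁰`
(certified Euler–Maclaurin evaluation of `ζ(σ)`, the tree's `zetaBox`, and convexity of `log ζ`; this is
how the values of (3.17) quoted in Trudgian §3.5 / Platt Thm. 5.4 are re-derived in the kernel).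
[cite: Edwards1974, §6.4 (Euler–Maclaurin summation for ζ)] [cite: Trudgian2011, §3.5] -/
theorem integral_le_of_meshCheck {x₀ xe : ℕ} {q₀ : ℤ} {L : List (ℕ × ℤ)} {TB : ℚ}
    (h : (trudgianTables.map fun T ↦ checkNode T x₀ q₀ true && checkNodes T L && sortedX x₀ L &&
        decide (lastX x₀ L = xe) && decide (trapSumQ ((x₀, q₀) :: L) ≤ TB)).getD false = true) :
    (∫ σ in ((x₀ : ℝ) / 10 ^ 4)..((xe : ℝ) / 10 ^ 4), Real.log ‖riemannZeta σ‖) ≤ (TB : ℝ) ∧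
      Real.log ‖riemannZeta ((((x₀ : ℝ) / 10 ^ 4 : ℝ)) : ℂ)‖ ≤ (q₀ : ℝ) / 10 ^ 10 := by
  generalize hT : trudgianTables = oT at h
  rcases oT with _ | T
  · simp at h
  have hTv : T.Valid := mkTables_valid hT
  simp only [Option.map_some, Option.getD_some, Bool.and_eq_true, decide_eq_true_eq] at h
  obtain ⟨⟨⟨⟨n1, N1⟩, s1⟩, l1⟩, t1⟩ := h
  have ok1 := nodeOK_of_checkNode hTv n1
  have L1 := nodeOK_of_checkNodes hTv N1
  have cons : ∀ p ∈ (x₀, q₀) :: L, NodeOK p := by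
    intro p hp
    rcases List.mem_cons.1 hp with rfl | hp
    · exact ok1
    · exact L1 p hp
  have I1 := integral_le_trapSumQ L x₀ q₀ s1 cons
  rw [l1] at I1
  have t1' : ((trapSumQ ((x₀, q₀) :: L) : ℚ) : ℝ) ≤ (TB : ℝ) := by exact_mod_cast t1
  exact ⟨I1.trans t1', ok1.2⟩

/-- **Soundness of a secant check** (upper node at `x₁`, lower node at `x₀`):
`log ζ(x₁/10⁴) ≤ q₁/10¹⁰` and `q₀/10¹⁰ ≤ log ζ(x₀/10⁴)` (certified Euler–Maclaurin evaluations).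
[cite: Edwards1974, §6.4 (Euler–Maclaurin summation for ζ)] [cite: Trudgian2011, §3.5] -/
theorem secant_of_check {x₀ x₁ : ℕ} {q₀ q₁ : ℤ}
    (h : (trudgianTables.map fun T ↦ checkNode T x₁ q₁ true && checkNode T x₀ q₀ false).getD false =
      true) :
    Real.log ‖riemannZeta ((((x₁ : ℝ) / 10 ^ 4 : ℝ)) : ℂ)‖ ≤ (q₁ : ℝ) / 10 ^ 10 ∧
      (q₀ : ℝ) / 10 ^ 10 ≤ Real.log ‖riemannZeta ((((x₀ : ℝ) / 10 ^ 4 : ℝ)) : ℂ)‖ := by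
  generalize hT : trudgianTables = oT at h
  rcases oT with _ | T
  · simp at h
  have hTv : T.Valid := mkTables_valid hT
  simp only [Option.map_some, Option.getD_some, Bool.and_eq_true] at h
  obtain ⟨n1, n0⟩ := h
  exact ⟨(nodeOK_of_checkNode hTv n1).2, (ge_of_checkNode hTv n0).2⟩

end TrudgianNumerics

/-! ### The arithmetic: from certified values to the printed constants -/

set_option maxHeartbeats 400000 in
/-- **Trudgian 2011, Theorem 3.3, granted the certified values** of `log ζ(1.17)`, `∫_{1.17}^{30} log ζ`, the secant
nodes at `1.38`, and `∫ log ζ` over `[1.38, 2.76]`, `[4.52, 30]`, `[1.38, 2.26]` (hypotheses, in the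
output format of `integral_le_of_meshCheck` / `secant_of_check`): Theorem 3.8 for one character with
the second-order constant at `(c, d, t₀) = (1.17, 0.88, 50)` gives
`π|∫S| ≤ 6.2016 + (b₁+b₂) log(Qt₂/2π) ≤ π(1.975 + 0.084 log(Qt₂/2π))`. [cite: Trudgian2011, §3 Theorem 3.3, p. 2270] -/
theorem trudgian2011_theorem33_of_bounds
    (hQ : Real.log ‖riemannZeta ((((11700 : ℕ) : ℝ) / 10 ^ 4 : ℝ) : ℂ)‖ ≤ ((18674551536 : ℤ) : ℝ) / 10 ^ 10)
    (hI1 : (∫ σ in (((11700 : ℕ) : ℝ) / 10 ^ 4)..(((300000 : ℕ) : ℝ) / 10 ^ 4),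
        Real.log ‖riemannZeta σ‖) ≤ (((13188773019 : ℚ) / 10 ^ 10 : ℚ) : ℝ))
    (hZm : Real.log ‖riemannZeta ((((13799 : ℕ) : ℝ) / 10 ^ 4 : ℝ) : ℂ)‖ ≤ ((11744720992 : ℤ) : ℝ) / 10 ^ 10)
    (hZ0 : ((11742601756 : ℤ) : ℝ) / 10 ^ 10 ≤ Real.log ‖riemannZeta ((((13800 : ℕ) : ℝ) / 10 ^ 4 : ℝ) : ℂ)‖)
    (hJ1 : (∫ σ in (((13800 : ℕ) : ℝ) / 10 ^ 4)..(((27600 : ℕ) : ℝ) / 10 ^ 4),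
        Real.log ‖riemannZeta σ‖) ≤ (((7332620881 : ℚ) / 10 ^ 10 : ℚ) : ℝ))
    (hJ2 : (∫ σ in (((45200 : ℕ) : ℝ) / 10 ^ 4)..(((300000 : ℕ) : ℝ) / 10 ^ 4),
        Real.log ‖riemannZeta σ‖) ≤ (((706698715 : ℚ) / 10 ^ 10 : ℚ) : ℝ))
    (hJ3 : (∫ σ in (((13800 : ℕ) : ℝ) / 10 ^ 4)..(((22600 : ℕ) : ℝ) / 10 ^ 4),
        Real.log ‖riemannZeta σ‖) ≤ (((5859226656 : ℚ) / 10 ^ 10 : ℚ) : ℝ)) :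
    trudgian2011_theorem33 := by
  intro q _ hq χ hχ t₁ t₂ h50 h12
  have hqR : (2 : ℝ) ≤ q := by exact_mod_cast (show 2 ≤ q by omega)
  -- numeric forms of the hypotheses
  have eQ : ((((11700 : ℕ) : ℝ) / 10 ^ 4 : ℝ)) = (117 / 100) := by norm_num
  have e30 : ((((300000 : ℕ) : ℝ) / 10 ^ 4 : ℝ)) = 30 := by norm_num
  have em : ((((13799 : ℕ) : ℝ) / 10 ^ 4 : ℝ)) = (69 / 50) - 1 / 10 ^ 4 := by norm_num
  have ehd : ((((13800 : ℕ) : ℝ) / 10 ^ 4 : ℝ)) = (69 / 50) := by norm_num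
  have e21 : ((((27600 : ℕ) : ℝ) / 10 ^ 4 : ℝ)) = (69 / 25) := by norm_num
  have e41 : ((((45200 : ℕ) : ℝ) / 10 ^ 4 : ℝ)) = (113 / 25) := by norm_num
  have ehd2 : ((((22600 : ℕ) : ℝ) / 10 ^ 4 : ℝ)) = (113 / 50) := by norm_num
  rw [eQ] at hQ hI1
  rw [e30] at hI1 hJ2
  rw [em] at hZm
  rw [ehd] at hZ0 hJ1 hJ3
  rw [e21] at hJ1
  rw [e41] at hJ2
  rw [ehd2] at hJ3
  push_cast at hI1 hJ1 hJ2 hJ3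
  simp only [Int.cast_ofNat] at hQ hZm hZ0
  -- the bound at non-ordinates, `t₀ = 50`
  refine TuringDirichlet.abs_integral_lfunctionArgS_le_of_forall_ne hq hχ (t₀ := 50) (A := 1.975)
    (B := 0.084) (by norm_num) ?_ h50 h12
  intro u v hu huv hzu hzv
  have hv : 50 < v := lt_of_lt_of_le hu huv
  have h := TuringDirichlet.abs_pi_mul_integral_lfunctionArgS_le₂ hq hχ (c := (117 / 100)) (d := (22 / 25))
    (t₀ := 50) (by norm_num) (by norm_num) (by norm_num) (by norm_num) (by norm_num) hu huv hzu hzv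
  have r1 : (2 * (1 / 2 + (22 / 25)) : ℝ) = (69 / 25) := by norm_num
  have r2 : (1 / 2 + (22 / 25) : ℝ) = (69 / 50) := by norm_num
  rw [r1, r2] at h
  -- `log(Qv/2π) ≥ 0`
  set L : ℝ := Real.log (q * v / (2 * π)) with hL
  have hL0 : 0 ≤ L := by
    apply Real.log_nonneg
    rw [le_div_iff₀ (by positivity)]
    have hπ := Real.pi_lt_d2
    have hqv := mul_le_mul hqR hv.le (by norm_num) (by linarith : (0:ℝ) ≤ q)
    linarith
  -- the pieces of the second-order constant
  have hπlo := Real.pi_gt_d6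
  have hπhi := Real.pi_lt_d4
  obtain ⟨hl40, hl4⟩ := TrudgianNumerics.log_four_le
  have P1 : logZeta (117 / 100) ≤ 18674551536 / 10 ^ 10 := by
    rw [TuringDirichlet.logZeta_eq_log_norm₃ (by norm_num)]; exact hQ
  have P2 : ∫ σ in Ioi ((117 / 100) : ℝ), logZeta σ ≤ 13188773019 / 10 ^ 10 + 1 / 10 ^ 8 := by
    have := TuringDirichlet.setIntegral_logZeta_le (c := (117 / 100)) (by norm_num) (by norm_num)
    linarith
  have P3 : 2 * (deriv riemannZeta (((69 / 25) : ℝ) : ℂ) / riemannZeta (((69 / 25) : ℝ) : ℂ)).re ≤ 0 := by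
    have := TuringDirichlet.re_logDeriv_zeta_ofReal_nonpos₃ (x := (69 / 25)) (by norm_num)
    linarith
  have P4 : -(deriv riemannZeta (((69 / 50) : ℝ) : ℂ) / riemannZeta (((69 / 50) : ℝ) : ℂ)).re ≤ 2.119236 := by
    have hs := neg_re_logDeriv_riemannZeta_le_secant (σ₀ := (69 / 50)) (h := 1 / 10 ^ 4)
      (by norm_num) (by norm_num)
    have e : (Real.log ‖riemannZeta (((69 / 50) - 1 / 10 ^ 4 : ℝ) : ℂ)‖ -
        Real.log ‖riemannZeta (((69 / 50) : ℝ) : ℂ)‖) / (1 / 10 ^ 4) =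
        10 ^ 4 * (Real.log ‖riemannZeta (((69 / 50) - 1 / 10 ^ 4 : ℝ) : ℂ)‖ -
          Real.log ‖riemannZeta (((69 / 50) : ℝ) : ℂ)‖) := by ring
    rw [e] at hs
    have : 10 ^ 4 * (Real.log ‖riemannZeta (((69 / 50) - 1 / 10 ^ 4 : ℝ) : ℂ)‖ -
          Real.log ‖riemannZeta (((69 / 50) : ℝ) : ℂ)‖) ≤ 2.119236 := by
      norm_num at hZm hZ0 ⊢
      linarith
    linarith
  have P5 : (25 : ℝ) / (16 * 50 ^ 2) + (2 / (3 * 50 ^ 3) + π / (6 * 50 ^ 2)) ≤ 0.00084 := by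
    have : π / (6 * 50 ^ 2) ≤ 3.1416 / (6 * 50 ^ 2) := div_le_div_of_nonneg_right hπhi.le (by norm_num)
    norm_num at this ⊢; linarith
  have P6 : (7 : ℝ) / (4 * 50 ^ 2) + (2 / (3 * 50 ^ 3) + π / (6 * 50 ^ 2)) ≤ 0.000915 := by
    have : π / (6 * 50 ^ 2) ≤ 3.1416 / (6 * 50 ^ 2) := div_le_div_of_nonneg_right hπhi.le (by norm_num)
    norm_num at this ⊢; linarith
  have P7 : -turingI (22 / 25) ≤ 7332620881 / 10 ^ 10 + 1 / 2 * (706698715 / 10 ^ 10 + 1 / 10 ^ 8) + 5859226656 / 10 ^ 10 := by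
    have e := TuringDirichlet.neg_turingI_eq ((22 / 25) : ℝ) (by norm_num)
    have s1 : (1 / 2 + (22 / 25) : ℝ) = (69 / 50) := by norm_num
    have s2 : (1 + 2 * (22 / 25) : ℝ) = (69 / 25) := by norm_num
    have s3 : (1 + 4 * (22 / 25) : ℝ) = (113 / 25) := by norm_num
    have s4 : (1 / 2 + 2 * (22 / 25) : ℝ) = (113 / 50) := by norm_num
    rw [s1, s2, s3, s4] at e
    have ht := TuringDirichlet.setIntegral_Ioi_log_norm_zeta_le (X := (113 / 25)) (by norm_num) (by norm_num)
    rw [e]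
    linarith
  -- the product term
  have hT1 : ((22 / 25) : ℝ) ^ 2 * Real.log 4 *
      (2 * (deriv riemannZeta (((69 / 25) : ℝ) : ℂ) / riemannZeta (((69 / 25) : ℝ) : ℂ)).re -
          (deriv riemannZeta (((69 / 50) : ℝ) : ℂ) / riemannZeta (((69 / 50) : ℝ) : ℂ)).re +
        (25 / (16 * 50 ^ 2) + (2 / (3 * 50 ^ 3) + π / (6 * 50 ^ 2)))) ≤ 2.27601 := by
    have hin : 2 * (deriv riemannZeta (((69 / 25) : ℝ) : ℂ) / riemannZeta (((69 / 25) : ℝ) : ℂ)).re -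
          (deriv riemannZeta (((69 / 50) : ℝ) : ℂ) / riemannZeta (((69 / 50) : ℝ) : ℂ)).re +
        (25 / (16 * 50 ^ 2) + (2 / (3 * 50 ^ 3) + π / (6 * 50 ^ 2))) ≤ 2.119236 + 0.00084 := by
      linarith
    calc ((22 / 25) : ℝ) ^ 2 * Real.log 4 * _ ≤ ((22 / 25) : ℝ) ^ 2 * Real.log 4 * (2.119236 + 0.00084) :=
          mul_le_mul_of_nonneg_left hin (by positivity)
      _ ≤ ((22 / 25) : ℝ) ^ 2 * 1.3862943616 * (2.119236 + 0.00084) := by nlinarith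
      _ ≤ 2.27601 := by norm_num
  have hT2 : ((22 / 25) : ℝ) ^ 2 * (7 / (4 * 50 ^ 2) + (2 / (3 * 50 ^ 3) + π / (6 * 50 ^ 2))) ≤ 0.00070858 := by
    calc ((22 / 25) : ℝ) ^ 2 * _ ≤ ((22 / 25) : ℝ) ^ 2 * 0.000915 := mul_le_mul_of_nonneg_left P6 (by positivity)
      _ ≤ 0.00070858 := by norm_num
  have hQ' : ((117 / 100) - 1 / 2 : ℝ) * logZeta (117 / 100) ≤ ((117 / 100) - 1 / 2) * (18674551536 / 10 ^ 10) :=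
    mul_le_mul_of_nonneg_left P1 (by norm_num)
  have hA₂ : (729 / (2048 * (50 : ℝ) ^ 2) + ((117 / 100) - 1 / 2) * logZeta (117 / 100) + ∫ σ in Ioi ((117 / 100) : ℝ), logZeta σ) +
      (((22 / 25) : ℝ) ^ 2 * Real.log 4 *
          (2 * (deriv riemannZeta (((69 / 25) : ℝ) : ℂ) / riemannZeta (((69 / 25) : ℝ) : ℂ)).re -
              (deriv riemannZeta (((69 / 50) : ℝ) : ℂ) / riemannZeta (((69 / 50) : ℝ) : ℂ)).re +
            (25 / (16 * 50 ^ 2) + (2 / (3 * 50 ^ 3) + π / (6 * 50 ^ 2)))) +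
        ((22 / 25) : ℝ) ^ 2 * (7 / (4 * 50 ^ 2) + (2 / (3 * 50 ^ 3) + π / (6 * 50 ^ 2))) - turingI (22 / 25)) ≤
      6.2016 := by
    norm_num at hQ' P2 P7 hT1 hT2 ⊢
    linarith
  have hB : (((117 / 100) - 1 / 2 : ℝ) ^ 2 / 4 + ((22 / 25) : ℝ) ^ 2 / 2 * (Real.log 4 - 1)) ≤ 0.084 * π := by
    linarith
  have hM : (6.2016 : ℝ) ≤ 1.975 * π := by linarith
  have hBL := mul_le_mul_of_nonneg_right hB hL0
  have hfin : π * |∫ t in u..v, lfunctionArgS χ t| ≤ π * (1.975 + 0.084 * L) := by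
    have e : π * (1.975 + 0.084 * L) = 1.975 * π + 0.084 * π * L := by ring
    rw [e]
    linarith
  exact le_of_mul_le_mul_left hfin Real.pi_pos

set_option maxHeartbeats 400000 in
/-- **Platt 2016, Theorem 5.4 (Trudgian), granted the certified values** of `log ζ(1.1)`, `∫_{1.1}^{30} log ζ`, the secant
nodes at `1.3`, and `∫ log ζ` over `[1.3, 2.6]`, `[4.2, 30]`, `[1.3, 2.1]` (hypotheses, in the
output format of `integral_le_of_meshCheck` / `secant_of_check`): Theorem 3.8 for one character with
the second-order constant at `(c, d, t₀) = (1.1, 0.8, 50)` gives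
`π|∫S| ≤ 6.8356 + (b₁+b₂) log(Q(T+h)/2π) ≤ π(2.17618 + 0.0679956 log(Q(T+h)/2π))`. [cite: Platt2016GRH, Theorem 5.4 p. 3014] -/
theorem platt2016_theorem54_of_bounds
    (hQ : Real.log ‖riemannZeta ((((11000 : ℕ) : ℝ) / 10 ^ 4 : ℝ) : ℂ)‖ ≤ ((23593857981 : ℤ) : ℝ) / 10 ^ 10)
    (hI1 : (∫ σ in (((11000 : ℕ) : ℝ) / 10 ^ 4)..(((300000 : ℕ) : ℝ) / 10 ^ 4),
        Real.log ‖riemannZeta σ‖) ≤ (((14648891725 : ℚ) / 10 ^ 10 : ℚ) : ℝ))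
    (hZm : Real.log ‖riemannZeta ((((12999 : ℕ) : ℝ) / 10 ^ 4 : ℝ) : ℂ)‖ ≤ ((13694161500 : ℤ) : ℝ) / 10 ^ 10)
    (hZ0 : ((13691352853 : ℤ) : ℝ) / 10 ^ 10 ≤ Real.log ‖riemannZeta ((((13000 : ℕ) : ℝ) / 10 ^ 4 : ℝ) : ℂ)‖)
    (hJ1 : (∫ σ in (((13000 : ℕ) : ℝ) / 10 ^ 4)..(((26000 : ℕ) : ℝ) / 10 ^ 4),
        Real.log ‖riemannZeta σ‖) ≤ (((7949537993 : ℚ) / 10 ^ 10 : ℚ) : ℝ))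
    (hJ2 : (∫ σ in (((42000 : ℕ) : ℝ) / 10 ^ 4)..(((300000 : ℕ) : ℝ) / 10 ^ 4),
        Real.log ‖riemannZeta σ‖) ≤ (((896613217 : ℚ) / 10 ^ 10 : ℚ) : ℝ))
    (hJ3 : (∫ σ in (((13000 : ℕ) : ℝ) / 10 ^ 4)..(((21000 : ℕ) : ℝ) / 10 ^ 4),
        Real.log ‖riemannZeta σ‖) ≤ (((6218597217 : ℚ) / 10 ^ 10 : ℚ) : ℝ)) :
    platt2016_theorem54 := by
  intro q _ hq χ hχ t₁ hh h50 hhpos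
  have h12 : t₁ < t₁ + hh := by linarith
  have hqR : (2 : ℝ) ≤ q := by exact_mod_cast (show 2 ≤ q by omega)
  -- numeric forms of the hypotheses
  have eQ : ((((11000 : ℕ) : ℝ) / 10 ^ 4 : ℝ)) = (11 / 10) := by norm_num
  have e30 : ((((300000 : ℕ) : ℝ) / 10 ^ 4 : ℝ)) = 30 := by norm_num
  have em : ((((12999 : ℕ) : ℝ) / 10 ^ 4 : ℝ)) = (13 / 10) - 1 / 10 ^ 4 := by norm_num
  have ehd : ((((13000 : ℕ) : ℝ) / 10 ^ 4 : ℝ)) = (13 / 10) := by norm_num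
  have e21 : ((((26000 : ℕ) : ℝ) / 10 ^ 4 : ℝ)) = (13 / 5) := by norm_num
  have e41 : ((((42000 : ℕ) : ℝ) / 10 ^ 4 : ℝ)) = (21 / 5) := by norm_num
  have ehd2 : ((((21000 : ℕ) : ℝ) / 10 ^ 4 : ℝ)) = (21 / 10) := by norm_num
  rw [eQ] at hQ hI1
  rw [e30] at hI1 hJ2
  rw [em] at hZm
  rw [ehd] at hZ0 hJ1 hJ3
  rw [e21] at hJ1
  rw [e41] at hJ2
  rw [ehd2] at hJ3
  push_cast at hI1 hJ1 hJ2 hJ3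
  simp only [Int.cast_ofNat] at hQ hZm hZ0
  -- the bound at non-ordinates, `t₀ = 50`
  refine TuringDirichlet.abs_integral_lfunctionArgS_le_of_forall_ne hq hχ (t₀ := 50) (A := 2.17618)
    (B := 0.0679956) (by norm_num) ?_ h50 h12
  intro u v hu huv hzu hzv
  have hv : 50 < v := lt_of_lt_of_le hu huv
  have h := TuringDirichlet.abs_pi_mul_integral_lfunctionArgS_le₂ hq hχ (c := (11 / 10)) (d := (4 / 5))
    (t₀ := 50) (by norm_num) (by norm_num) (by norm_num) (by norm_num) (by norm_num) hu huv hzu hzv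
  have r1 : (2 * (1 / 2 + (4 / 5)) : ℝ) = (13 / 5) := by norm_num
  have r2 : (1 / 2 + (4 / 5) : ℝ) = (13 / 10) := by norm_num
  rw [r1, r2] at h
  -- `log(Qv/2π) ≥ 0`
  set L : ℝ := Real.log (q * v / (2 * π)) with hL
  have hL0 : 0 ≤ L := by
    apply Real.log_nonneg
    rw [le_div_iff₀ (by positivity)]
    have hπ := Real.pi_lt_d2
    have hqv := mul_le_mul hqR hv.le (by norm_num) (by linarith : (0:ℝ) ≤ q)
    linarith
  -- the pieces of the second-order constant
  have hπlo := Real.pi_gt_d6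
  have hπhi := Real.pi_lt_d4
  obtain ⟨hl40, hl4⟩ := TrudgianNumerics.log_four_le
  have P1 : logZeta (11 / 10) ≤ 23593857981 / 10 ^ 10 := by
    rw [TuringDirichlet.logZeta_eq_log_norm₃ (by norm_num)]; exact hQ
  have P2 : ∫ σ in Ioi ((11 / 10) : ℝ), logZeta σ ≤ 14648891725 / 10 ^ 10 + 1 / 10 ^ 8 := by
    have := TuringDirichlet.setIntegral_logZeta_le (c := (11 / 10)) (by norm_num) (by norm_num)
    linarith
  have P3 : 2 * (deriv riemannZeta (((13 / 5) : ℝ) : ℂ) / riemannZeta (((13 / 5) : ℝ) : ℂ)).re ≤ 0 := by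
    have := TuringDirichlet.re_logDeriv_zeta_ofReal_nonpos₃ (x := (13 / 5)) (by norm_num)
    linarith
  have P4 : -(deriv riemannZeta (((13 / 10) : ℝ) : ℂ) / riemannZeta (((13 / 10) : ℝ) : ℂ)).re ≤ 2.808647 := by
    have hs := neg_re_logDeriv_riemannZeta_le_secant (σ₀ := (13 / 10)) (h := 1 / 10 ^ 4)
      (by norm_num) (by norm_num)
    have e : (Real.log ‖riemannZeta (((13 / 10) - 1 / 10 ^ 4 : ℝ) : ℂ)‖ -
        Real.log ‖riemannZeta (((13 / 10) : ℝ) : ℂ)‖) / (1 / 10 ^ 4) =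
        10 ^ 4 * (Real.log ‖riemannZeta (((13 / 10) - 1 / 10 ^ 4 : ℝ) : ℂ)‖ -
          Real.log ‖riemannZeta (((13 / 10) : ℝ) : ℂ)‖) := by ring
    rw [e] at hs
    have : 10 ^ 4 * (Real.log ‖riemannZeta (((13 / 10) - 1 / 10 ^ 4 : ℝ) : ℂ)‖ -
          Real.log ‖riemannZeta (((13 / 10) : ℝ) : ℂ)‖) ≤ 2.808647 := by
      norm_num at hZm hZ0 ⊢
      linarith
    linarith
  have P5 : (25 : ℝ) / (16 * 50 ^ 2) + (2 / (3 * 50 ^ 3) + π / (6 * 50 ^ 2)) ≤ 0.00084 := by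
    have : π / (6 * 50 ^ 2) ≤ 3.1416 / (6 * 50 ^ 2) := div_le_div_of_nonneg_right hπhi.le (by norm_num)
    norm_num at this ⊢; linarith
  have P6 : (7 : ℝ) / (4 * 50 ^ 2) + (2 / (3 * 50 ^ 3) + π / (6 * 50 ^ 2)) ≤ 0.000915 := by
    have : π / (6 * 50 ^ 2) ≤ 3.1416 / (6 * 50 ^ 2) := div_le_div_of_nonneg_right hπhi.le (by norm_num)
    norm_num at this ⊢; linarith
  have P7 : -turingI (4 / 5) ≤ 7949537993 / 10 ^ 10 + 1 / 2 * (896613217 / 10 ^ 10 + 1 / 10 ^ 8) + 6218597217 / 10 ^ 10 := by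
    have e := TuringDirichlet.neg_turingI_eq ((4 / 5) : ℝ) (by norm_num)
    have s1 : (1 / 2 + (4 / 5) : ℝ) = (13 / 10) := by norm_num
    have s2 : (1 + 2 * (4 / 5) : ℝ) = (13 / 5) := by norm_num
    have s3 : (1 + 4 * (4 / 5) : ℝ) = (21 / 5) := by norm_num
    have s4 : (1 / 2 + 2 * (4 / 5) : ℝ) = (21 / 10) := by norm_num
    rw [s1, s2, s3, s4] at e
    have ht := TuringDirichlet.setIntegral_Ioi_log_norm_zeta_le (X := (21 / 5)) (by norm_num) (by norm_num)
    rw [e]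
    linarith
  -- the product term
  have hT1 : ((4 / 5) : ℝ) ^ 2 * Real.log 4 *
      (2 * (deriv riemannZeta (((13 / 5) : ℝ) : ℂ) / riemannZeta (((13 / 5) : ℝ) : ℂ)).re -
          (deriv riemannZeta (((13 / 10) : ℝ) : ℂ) / riemannZeta (((13 / 10) : ℝ) : ℂ)).re +
        (25 / (16 * 50 ^ 2) + (2 / (3 * 50 ^ 3) + π / (6 * 50 ^ 2)))) ≤ 2.492657 := by
    have hin : 2 * (deriv riemannZeta (((13 / 5) : ℝ) : ℂ) / riemannZeta (((13 / 5) : ℝ) : ℂ)).re -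
          (deriv riemannZeta (((13 / 10) : ℝ) : ℂ) / riemannZeta (((13 / 10) : ℝ) : ℂ)).re +
        (25 / (16 * 50 ^ 2) + (2 / (3 * 50 ^ 3) + π / (6 * 50 ^ 2))) ≤ 2.808647 + 0.00084 := by
      linarith
    calc ((4 / 5) : ℝ) ^ 2 * Real.log 4 * _ ≤ ((4 / 5) : ℝ) ^ 2 * Real.log 4 * (2.808647 + 0.00084) :=
          mul_le_mul_of_nonneg_left hin (by positivity)
      _ ≤ ((4 / 5) : ℝ) ^ 2 * 1.3862943616 * (2.808647 + 0.00084) := by nlinarith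
      _ ≤ 2.492657 := by norm_num
  have hT2 : ((4 / 5) : ℝ) ^ 2 * (7 / (4 * 50 ^ 2) + (2 / (3 * 50 ^ 3) + π / (6 * 50 ^ 2))) ≤ 0.0005856 := by
    calc ((4 / 5) : ℝ) ^ 2 * _ ≤ ((4 / 5) : ℝ) ^ 2 * 0.000915 := mul_le_mul_of_nonneg_left P6 (by positivity)
      _ ≤ 0.0005856 := by norm_num
  have hQ' : ((11 / 10) - 1 / 2 : ℝ) * logZeta (11 / 10) ≤ ((11 / 10) - 1 / 2) * (23593857981 / 10 ^ 10) :=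
    mul_le_mul_of_nonneg_left P1 (by norm_num)
  have hA₂ : (729 / (2048 * (50 : ℝ) ^ 2) + ((11 / 10) - 1 / 2) * logZeta (11 / 10) + ∫ σ in Ioi ((11 / 10) : ℝ), logZeta σ) +
      (((4 / 5) : ℝ) ^ 2 * Real.log 4 *
          (2 * (deriv riemannZeta (((13 / 5) : ℝ) : ℂ) / riemannZeta (((13 / 5) : ℝ) : ℂ)).re -
              (deriv riemannZeta (((13 / 10) : ℝ) : ℂ) / riemannZeta (((13 / 10) : ℝ) : ℂ)).re +
            (25 / (16 * 50 ^ 2) + (2 / (3 * 50 ^ 3) + π / (6 * 50 ^ 2)))) +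
        ((4 / 5) : ℝ) ^ 2 * (7 / (4 * 50 ^ 2) + (2 / (3 * 50 ^ 3) + π / (6 * 50 ^ 2))) - turingI (4 / 5)) ≤
      6.8356 := by
    norm_num at hQ' P2 P7 hT1 hT2 ⊢
    linarith
  have hB : (((11 / 10) - 1 / 2 : ℝ) ^ 2 / 4 + ((4 / 5) : ℝ) ^ 2 / 2 * (Real.log 4 - 1)) ≤ 0.0679956 * π := by
    linarith
  have hM : (6.8356 : ℝ) ≤ 2.17618 * π := by linarith
  have hBL := mul_le_mul_of_nonneg_right hB hL0
  have hfin : π * |∫ t in u..v, lfunctionArgS χ t| ≤ π * (2.17618 + 0.0679956 * L) := by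
    have e : π * (2.17618 + 0.0679956 * L) = 2.17618 * π + 0.0679956 * π * L := by ring
    rw [e]
    linarith
  exact le_of_mul_le_mul_left hfin Real.pi_pos

end Literature.NumberTheory.LFunctions

end
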